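import Literature.MathematicalPhysics.QuantumFieldTheory.Balaban1983to89.B9Eq343HolderGlobalFromLocalZd
import Literature.MathematicalPhysics.QuantumFieldTheory.Balaban1983to89.B9Eq343CutoffFamilyZd
import Literature.MathematicalPhysics.QuantumFieldTheory.Balaban1983to89.B9Eq347GlobalFromLocalZdFinite

/-!
# `Balaban1983to89.B9Eq343HolderBothZdFinite` — [Balaban1985RegularSpaces] (1.36) p. 82 ∕ (1.62) + Prop. 3 p. 87 «‖A‖_{1,β} < 5dLB₀(β)(α₀+α₁)(Lʲη)^{−2−β}
# on Ω_j … B₀(β₀) are the corresponding norms of the operators G(U₀), H(U₀)» READ WITH BOTH POINTS OF THE PAIR IN Ω_j, from [Balaban1985BackgroundPropagators]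
# Thm 3.3's (3.42) + (3.43) AT THE GENUINE READINGS and the [Balaban1984PropagatorsII] Lemma-2.1 letters: THE CAPSTONE of the Hölder summation on a member
# with finitely many blocks — near pairs by (3.43) with the canonical cut-off `zetaZd`, far pairs by (3.42) n = 1 at both endpoints

statement-level skeleton of published theorems with citation tags; proofs where landed; nothing here is a claim about the
Yang–Mills mass gap

PDF held: `paper:balaban1985-cmp99-background-propagators` ([4] = B9; journal page = PDF page + 388) pp. 397–398 ((3.40)–(3.43), (3.47), l. 17–20);
`paper:balaban1985-cmp99-regular-spaces-gauge-fixing` (B8; journal page = PDF page + 74) p. 82 (1.36), p. 86 (1.59), p. 87 (1.62) + Prop. 3 (page images read by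
this seat, 2026-08-28); [Balaban1984PropagatorsII] p. 234 Lemma 2.1 (2.60)–(2.61) through leaf-03's `B9Eq347GlobalFromLocal` — BY NAME.  PRINT WORD of the [B9]
page owner (lit-balaban-r06 g63, cell bus 2026-08-28T01:51Z): «[B9] Thm 3.1 prints NO global weighted HÖLDER inequality … a GLOBAL weighted Hölder binder is a TREE
statement to be DERIVED from (3.43) + [4] Lemma 2.1 with the powers split between the TWO localisation indices … print never weighs a pair by the level of its
first point alone».

WHY THIS FILE (cell `pub-ymgap`, HUMAN RULING D-0062 ∕ D-0149; seat `pub-ymgap-dag-n06-w2` (g2), node N06 = [B9]; INTENT-3; count-neutral).  INTENT-1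
(`B9Eq343HolderGlobalFromLocalZd`) summed (3.43) for ANY cut-off family and bounded far pairs by the two endpoint values; INTENT-2 (`B9Eq343CutoffFamilyZd`) built
the canonical family `ζ_y` (`= 1` on `Δ(y)`'s core, supported in `Δ̃(y)`, far-pair gap `⌊Lʲ∕4⌋ < |x − x′|_∞`).  THIS FILE puts them together at `ζ := zetaZd`: for
a pair `(x, x′)` with BOTH points in `Ω_j` — print B8 (1.36) «on Ω_j» — either `x′` lies in the core of the block `Δ(u) ∋ x` (NEAR: the cut-off is `1` at both
points and drops out) or it does not (FAR: the pair is longer than `L^{j_u}η∕4 ≥ Lʲη∕4`, and the quotient costs the two sup values `(Lʲη)²|∇_νGf̃(x)|`,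
`(Lʲη)²|∇_νGf̃(x′)|`, each an instance of g0's n = 1 entry `weight_mul_norm_gradGop_le_of_ineq342` AT ITS OWN ENDPOINT's BLOCK — the step that needs `x′ ∈ Ω_j`).
Result: the REPAIRED Hölder binder (both-points class) is supplied on finite members by Theorem 3.3's two blocks at the genuine readings, with every constant
displayed through the Lemma-2.1 letters; the typed first-point class (`B9SupplySockB9P3ZdAt.HolderAt` ∕ `…GammaUnivDelta.HolderAtδ`) has no such supplier
(LOCATED (L-H1) of INTENT-1).

WHAT IS PROVED (0 sorry; proof lane — no `def`).
* §1 `scale_mono` (`Lʲη ≤ L^{j′}η` for `j ≤ j′`, `L ≥ 1`), `weight_holder_le` ∕ `weight_two_le` (class weight ≤ block weight), `quarter_scale_le_len` (the far-pair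
  length: `x ∈ Δ(u)`, `x′ ∉ core(u)`, `len ≥ |·|_∞` ⇒ `(L^{j_u}η)∕4 ≤ η·len(x′−x)`).
* §2 ★★★ `weight_mul_hquot_gradGop_le_both` — THE POINTWISE BOUND: data `h342 : B9.Ineq342_346_347 (GAZdOfOps …) B₀ δ₀ U`, `h345 : B9.Ineq343_345 (GAZdOfOps …) Bβ Bε
  Bεβ δ₀ U`, `0 ≤ β < 1`, `G(U)` ℝ-linear (displayed), a bond class `P` with base-block assignment `π` such that (G1) every bond based at a site of some `Ω_j`
  (`j ≤ m`) is in the class, (G2) a class index of the base point is `≤` the block's level; a length function with `1 ≤ len` on admissible displacements and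
  `|·|_∞ ≤ len` (`l1Len` qualifies: `one_le_l1Len`, `linfDist_le_l1Len`); the three Lemma-2.1 letters DISPLAYED — the Hölder exchange
  `(L^{j_u}η)^{2+β}·(L^{j_u}η)^{1−β}·cutHZd(ζ_u) ≤ R·e^{κ₂d(u,v)}·ω(v)`, the sup exchange `(L^{j_u}η)²·(L^{j_u}η) ≤ R₁·e^{κ₂d(u,v)}·ω(v)`, the row `Σ_v e^{−(δ₀−κ₂)d(u,v)}
  ≤ S`.  Conclusion: for every `f` on the class with `ω(π y)‖f(y)‖ ≤ M`, every `j ≤ m`, components `ν, μ`, and every admissible pair with `x ∈ Ω_j` AND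
  `x′ ∈ Ω_j`: `(Lʲη)^{2+β}·hquot(∇_{U,ν}G(U)f̃)_μ(x,x′) ≤ (max{0,Bβ β}·R·S + 2·4^β·B₀·R₁·S)·M`.
* §3 ★★ `holderBoth_msup_le` — the same as the weighted-sup statement of the REPAIRED binder's shape:
  `msup L m η (−(2+β)) {(ν,μ,(x,x′)) : admissible, x ∈ Ω_j, x′ ∈ Ω_j} (hquot …) ≤ (…)·M`; ★ `holderBoth_msup_le_bondNorm` — with `M := |f̃|₍₋₃₎` when (G3) every
  block's level is a class of its bonds and the `(−3)`-family of `f̃` is bounded (print's right-hand side «B₀(β)|J|₍₋₃₎»).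
  ★ `holderBoth_msup_le_CH` — the same bound in the binder owner's EDITION-δ₂ shape `max{R·S, 2·4^β·R₁·S}·(B₀ + max{0,Bβ β})·M` (dag-n06-b word 02:09Z).
* §4 ★★ `holderBoth_msup_le_fintype` — LETTER-FREE ON ONE FINITE MEMBER (g0's `…ZdFinite` road): the three Lemma-2.1 letters inhabited by member-dependent constants
  (`exchangeLetter_of_fintype` at `κ₂ := 0`, `rowLetter_of_fintype`, `0 ≤ δ₀`), block assignment by choice (`blkChoice`); displayed: the member's geometry
  (G1′) `hcover` (sites of `Ω_j` lie in blocks) and (G2′) `hlevel` (a level-`j_y` block meets `Ω_j` only for `j ≤ j_y`), and Theorem 3.3's two blocks.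
* §5 A6 ★ `holderBoth_hypotheses_inhabited` — the hypothesis set of §4 is JOINTLY SATISFIABLE: the single-site member (`Ω₀ = Λ₀ = {0}`, `m = 0`) with the
  zero letter record and `U = 1` (every reading of `GAZdOfOps` vanishes, g0's `…_gop_zero`); (G1′)(G2′) checked there.  Labelled A6, not print's regime.
HONEST SCOPE.  Bookkeeping over INTENT-1∕2, g0's n = 1 entry and leaf-03; nothing of [4] Thm 3.1∕3.3 asserted (`h342`, `h345` are the junction's hypotheses at
the genuine readings); `G(U₀)` a letter; block assignment (G1)–(G3) and the three Lemma-2.1 letters DISPLAYED — on a finite member they are finitely many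
inequalities (inhabited member by member, constants member-dependent through `cutHZd(ζ_u) ≈ (L^{j_u}η)^{−β}`, LOCATED (L-H2); member-UNIFORM `R` needs the
ξ-scaled cut-off norm of print, `B9Eq343CutoffFamilyZd.xiScaled_hquot_zetaZd_le`).  The univ road (infinitely many blocks) is not covered.  Whether the junction's
binder is re-typed to the both-points class (and fed the (3.42) block it needs for far pairs) is the binder owner's call (dag-n06-b).  Count-neutral; N05∕N06 NOT
discharged; one finite lattice programme at fixed `ε`; R4 closes the conditional finite-𝕋⁴ rung `BalabanLadder.UV` only; nothing continuum ∕ ℝ⁴ ∕ OS ∕ mass-gap ∕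
Clay.  Unit `pub-ymgap-dag-n06-w2` (g2), 2026-08-28.
-/

noncomputable section

namespace Literature.MathematicalPhysics.QuantumFieldTheory.Balaban1983to89.B9Eq343HolderBothZdFinite

open B7Prop1Local (InBox)
open B8Ineq132 (covDerivFwd BondTouches)
open B8ScaledSupNorm (msup weight Bdd weight_mul_norm_le_msup bondNorm)
open B8LeafModelZd (ZdIdx)
open B9Eq340HolderZd (hquot AdmPair hquot_nonneg)
open B9SupplySockB9P3ZdLetters (OpsZd)
open B9SupplySockB9P3ZdFrame (MemberZd BSite blockZd blockTZd CfgZd distZd cutHZd)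
open B9SupplySockB9P3ZdLocalLettersOfOps (cdBZd GAZdOfOps)
open B9Eq347GlobalFromLocalZd (extZd weight_mul_norm_gradGop_le_of_ineq342)
open B9Eq347GlobalFromLocalZdFinite (InSomeBlock blkChoice blkChoice_spec rowLetter_of_fintype exchangeLetter_of_fintype exchangeConst_nonneg)
open B9Eq343HolderGlobalFromLocalZd (weight_mul_hquot_gradGop_le_of_ineq343 weight_mul_hquot_le_of_far)
open B9Eq343CutoffFamilyZd (zetaZd coreZd rampZd zetaZd_eq_one_of_mem_blockZd zetaZd_eq_one_of_mem_coreZd mem_blockTZd_of_zetaZd_ne_zero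
  rampZd_lt_linfDist pow_le_four_mul_rampZd_succ)
open LatticeNorms (linfDist)

-- `Site` alone could resolve to the torus sites of `Setup.lean`; re-export the `ℤ^d` sites of `B7Prop1Explicit`.
export B7Prop1Explicit (Site)

variable {d : ℕ}

/-! ## §1 Class weight ≤ block weight; the far-pair length -/

/-- `Lʲη ≤ L^{j′}η` for `j ≤ j′` (`L ≥ 1`, `η ≥ 0`): the scale of a coarser class is at most the block's. [cite: Balaban1985BackgroundPropagators, (3.41) p.397 (bookkeeping)] -/
theorem scale_mono {L : ℕ} (hL : 1 ≤ L) {η : ℝ} (hη : 0 ≤ η) {j j' : ℕ} (hj : j ≤ j') : (L : ℝ) ^ j * η ≤ (L : ℝ) ^ j' * η :=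
  mul_le_mul_of_nonneg_right (pow_le_pow_right₀ (by exact_mod_cast hL) hj) hη

/-- the Hölder class weight is below the block weight: `(Lʲη)^{2+β} ≤ (L^{j′}η)^{2+β}` for `j ≤ j′`, `0 ≤ β`.
[cite: Balaban1985BackgroundPropagators, (3.41) p.397; Balaban1985RegularSpaces, (1.36) p.82 (bookkeeping)] -/
theorem weight_holder_le {L : ℕ} (hL : 1 ≤ L) {η : ℝ} (hη : 0 < η) {β : ℝ} (hβ : 0 ≤ β) {j j' : ℕ} (hj : j ≤ j') :
    weight L η (-(2 + β)) j ≤ ((L : ℝ) ^ j' * η) ^ (2 + β) := by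
  rw [B8ScaledSupNorm.weight, neg_neg]
  exact Real.rpow_le_rpow (B8ScaledSupNorm.scale_pos hL hη j).le (scale_mono hL hη.le hj) (by linarith)

/-- the sup class weight is below the block weight: `(Lʲη)² ≤ (L^{j′}η)²` for `j ≤ j′` (rpow exponent `2`).
[cite: Balaban1985BackgroundPropagators, (3.41) p.397 (bookkeeping)] -/
theorem weight_two_le {L : ℕ} (hL : 1 ≤ L) {η : ℝ} (hη : 0 < η) {j j' : ℕ} (hj : j ≤ j') :
    weight L η (-(2 : ℝ)) j ≤ ((L : ℝ) ^ j' * η) ^ 2 := by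
  rw [B8ScaledSupNorm.weight, neg_neg, Real.rpow_two]
  exact pow_le_pow_left₀ (B8ScaledSupNorm.scale_pos hL hη j).le (scale_mono hL hη.le hj) 2

/-- **the far-pair length**: `x ∈ Δ(u)` (block of level `j_u`), `x′` outside the core of `Δ̃(u)`, and a length function dominating the sup-distance ⟹
`(L^{j_u}η)∕4 ≤ η·len(x′ − x)`. [cite: Balaban1985BackgroundPropagators, p.397 (Δ(y), Δ̃(y)), (3.40) p.397] -/
theorem quarter_scale_le_len {L : ℕ} {j : ℕ} {y x x' : Site d} {η : ℝ} (hη : 0 ≤ η) {len : Site d → ℝ}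
    (hlen : ∀ z z' : Site d, (linfDist z z' : ℝ) ≤ len (z' - z)) (hx : x ∈ blockZd L j y) (hx' : x' ∉ coreZd L j y) :
    (1 / 4 : ℝ) * ((L : ℝ) ^ j * η) ≤ η * len (x' - x) := by
  have h1 : rampZd L j < linfDist x x' := rampZd_lt_linfDist hx hx'
  have h2 : (rampZd L j : ℝ) + 1 ≤ (linfDist x x' : ℝ) := by exact_mod_cast h1
  have h3 := pow_le_four_mul_rampZd_succ L j
  have h4 := hlen x x'
  have h5 : (L : ℝ) ^ j ≤ 4 * len (x' - x) := by linarith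
  nlinarith

/-! ## §2 The pointwise bound for a pair with both points in `Ω_j` -/

section Main

variable {𝔸 : Type} [CStarAlgebra 𝔸] [Nontrivial 𝔸] {L : ℕ} {len : Site d → ℝ}

-- budget line: two long instantiations + case split; elaborates inside the default today, margin for Mathlib drift
set_option maxHeartbeats 400000 in
/-- ★★★ **THE REPAIRED HÖLDER LINE, POINTWISE: BOTH POINTS IN Ω_j** (B8 (1.36)∕(1.62) «‖∇_UG(U₀)J‖_β-type ≤ B₀(β)(Lʲη)^{−2−β}|J|₍₋₃₎ on Ω_j» from [B9] Thm 3.3's (3.42) +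
(3.43) at the genuine readings and [4] Lemma 2.1's letters, on a member with finitely many blocks).  For `x, x′ ∈ Ω_j` admissible, with `u = π(x,μ)` the block of
`x`: NEAR (`x′ ∈ core(u)`) — `ζ_u(x) = ζ_u(x′) = 1`, INTENT-1's summed (3.43) at block weight `(L^{j_u}η)^{2+β} ≥ (Lʲη)^{2+β}`; FAR (`x′ ∉ core(u)`) — `η·len ≥ L^{j_u}η∕4 ≥
Lʲη∕4`, INTENT-1's two-endpoint bound with `c = 1∕4`, then g0's n = 1 entry at `π(x,μ)` and at `π(x′,μ)` (class weight `(Lʲη)²` ≤ either block weight BECAUSE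
`x′ ∈ Ω_j` too).  Bound: `(Lʲη)^{2+β}·hquot ≤ (max{0,Bβ β}·R·S + 2·4^β·B₀·R₁·S)·M`.
[cite: Balaban1985RegularSpaces, (1.36) p.82, (1.59) p.86, (1.62) + Prop. 3 p.87; Balaban1985BackgroundPropagators, (3.42) p.397, (3.43) + (3.47) p.398 + p.398 l.17–20, Thm 3.3 p.399; Balaban1984PropagatorsII, Lemma 2.1 (2.60)–(2.61) p.234] -/
theorem weight_mul_hquot_gradGop_le_both {x : MemberZd d L} [Fintype (BSite L x)] (hL : 1 ≤ L) {ops : OpsZd d 𝔸} {U : CfgZd d 𝔸}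
    {B₀ δ₀ β : ℝ} {Bβ Bε : ℝ → ℝ} {Bεβ : ℝ → ℝ → ℝ} (hB₀ : 0 ≤ B₀)
    (h342 : B9.Ineq342_346_347 (GAZdOfOps 𝔸 L len x ops) B₀ δ₀ U) (h345 : B9.Ineq343_345 (GAZdOfOps 𝔸 L len x ops) Bβ Bε Bεβ δ₀ U)
    (hβ0 : 0 ≤ β) (hβ1 : β < 1) (hlen1 : ∀ v : Site d, 0 < len v → 1 ≤ len v)
    (hlen : ∀ z z' : Site d, (linfDist z z' : ℝ) ≤ len (z' - z))
    (hlin : ∀ (c : ℝ) (A B : Site d → Fin d → 𝔸), ops.Gop U.1 (c • A + B) = c • ops.Gop U.1 A + ops.Gop U.1 B)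
    {P : Site d × Fin d → Prop} (π : {b : Site d × Fin d // P b} → BSite L x)
    (hπ : ∀ b, b.1.1 ∈ blockZd L (π b).1.1 (π b).1.2)
    (hPΩ : ∀ j, j ≤ x.m → ∀ (z : Site d) (μ : Fin d), z ∈ x.i.Ω j → P (z, μ))
    (hlev : ∀ (b : {b : Site d × Fin d // P b}) (j : ℕ), j ≤ x.m → b.1.1 ∈ x.i.Ω j → j ≤ (π b).1.1)
    {κ₂ R R₁ S : ℝ} (hR : 0 ≤ R) (hR₁ : 0 ≤ R₁) {ω : BSite L x → ℝ} (hω : ∀ v, 0 < ω v)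
    (hexH : ∀ u v : BSite L x, ((L : ℝ) ^ u.1.1 * x.i.η) ^ (2 + β) *
      (((L : ℝ) ^ u.1.1 * x.i.η) ^ (1 - β) * cutHZd x.i.η β len (zetaZd L u.1.1 u.1.2)) ≤ R * Real.exp (κ₂ * distZd L x u v) * ω v)
    (hex1 : ∀ u v : BSite L x, ((L : ℝ) ^ u.1.1 * x.i.η) ^ 2 * ((L : ℝ) ^ u.1.1 * x.i.η) ≤ R₁ * Real.exp (κ₂ * distZd L x u v) * ω v)
    (hS : ∀ u : BSite L x, ∑ v, Real.exp (-((δ₀ - κ₂) * distZd L x u v)) ≤ S)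
    (ν : Fin d) (f : {b : Site d × Fin d // P b} → 𝔸) {M : ℝ} (hM : 0 ≤ M) (hMf : ∀ y, ω (π y) * ‖f y‖ ≤ M)
    {j : ℕ} (hj : j ≤ x.m) (μ : Fin d) {p : Site d × Site d} (hp : p ∈ AdmPair x.i.η len) (hxΩ : p.1 ∈ x.i.Ω j) (hx'Ω : p.2 ∈ x.i.Ω j) :
    weight L x.i.η (-(2 + β)) j * hquot x.i.η β len U.1 (covDerivFwd x.i.η U.1 ν (fun z => ops.Gop U.1 (extZd P f) z μ)) p ≤
      (max 0 (Bβ β) * R * S + 2 * (4 : ℝ) ^ β * (B₀ * R₁ * S)) * M := by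
  have hη : 0 < x.i.η := x.i.hη
  have hS0 : 0 ≤ S := (Finset.sum_nonneg fun v _ => Real.exp_nonneg _).trans (hS (π ⟨(p.1, μ), hPΩ j hj p.1 μ hxΩ⟩))
  -- the two endpoint bonds, their blocks, and the weight comparisons
  set b : {b : Site d × Fin d // P b} := ⟨(p.1, μ), hPΩ j hj p.1 μ hxΩ⟩ with hb
  set b' : {b : Site d × Fin d // P b} := ⟨(p.2, μ), hPΩ j hj p.2 μ hx'Ω⟩ with hb'
  have hju : j ≤ (π b).1.1 := hlev b j hj hxΩ
  have hju' : j ≤ (π b').1.1 := hlev b' j hj hx'Ω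
  have hxblk : p.1 ∈ blockZd L (π b).1.1 (π b).1.2 := hπ b
  have hq0 : 0 ≤ hquot x.i.η β len U.1 (covDerivFwd x.i.η U.1 ν (fun z => ops.Gop U.1 (extZd P f) z μ)) p := hquot_nonneg hη.le β U.1 _ hp
  have hnear0 : 0 ≤ max 0 (Bβ β) * R * S * M := by positivity
  have hfar0 : 0 ≤ 2 * (4 : ℝ) ^ β * (B₀ * R₁ * S) * M := by positivity
  by_cases hcore : p.2 ∈ coreZd L (π b).1.1 (π b).1.2
  · -- NEAR: the cut-off of the block of `x` is 1 at both points
    have h1 : zetaZd L (π b).1.1 (π b).1.2 p.1 = 1 := zetaZd_eq_one_of_mem_blockZd hxblk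
    have h2 : zetaZd L (π b).1.1 (π b).1.2 p.2 = 1 := zetaZd_eq_one_of_mem_coreZd hcore
    have hnear := weight_mul_hquot_gradGop_le_of_ineq343 (len := len) h345 hβ0 hβ1 hlen1 hlin (fun u => zetaZd L u.1.1 u.1.2)
      (fun u z hz => mem_blockTZd_of_zetaZd_ne_zero hz) π hπ hR hω
      (fun u => Real.rpow_nonneg (B8ScaledSupNorm.scale_pos hL hη u.1.1).le _) hexH hS ν f hM hMf (π b) μ hp h1 h2
    have hw : weight L x.i.η (-(2 + β)) j ≤ ((L : ℝ) ^ (π b).1.1 * x.i.η) ^ (2 + β) := weight_holder_le hL hη hβ0 hju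
    calc weight L x.i.η (-(2 + β)) j * hquot x.i.η β len U.1 (covDerivFwd x.i.η U.1 ν (fun z => ops.Gop U.1 (extZd P f) z μ)) p
        ≤ ((L : ℝ) ^ (π b).1.1 * x.i.η) ^ (2 + β) * hquot x.i.η β len U.1 (covDerivFwd x.i.η U.1 ν (fun z => ops.Gop U.1 (extZd P f) z μ)) p :=
          mul_le_mul_of_nonneg_right hw hq0
      _ ≤ max 0 (Bβ β) * R * S * M := hnear
      _ ≤ (max 0 (Bβ β) * R * S + 2 * (4 : ℝ) ^ β * (B₀ * R₁ * S)) * M := by nlinarith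
  · -- FAR: the pair is longer than a quarter of the block scale; two endpoint sup values
    have hfarlen : (1 / 4 : ℝ) * ((L : ℝ) ^ j * x.i.η) ≤ x.i.η * len (p.2 - p.1) :=
      le_trans (mul_le_mul_of_nonneg_left (scale_mono hL hη.le hju) (by norm_num)) (quarter_scale_le_len hη.le hlen hxblk hcore)
    have hfar := weight_mul_hquot_le_of_far (len := len) hL U hβ0 (covDerivFwd x.i.η U.1 ν (fun z => ops.Gop U.1 (extZd P f) z μ)) hp j
      (by norm_num : (0 : ℝ) < 1 / 4) hfarlen
    -- the two endpoint values through g0's n = 1 entry, each at its own block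
    have hend : ∀ (z : Site d) (hz : P (z, μ)), j ≤ (π ⟨(z, μ), hz⟩).1.1 →
        weight L x.i.η (-(2 : ℝ)) j * ‖covDerivFwd x.i.η U.1 ν (fun w => ops.Gop U.1 (extZd P f) w μ) z‖ ≤ B₀ * R₁ * S * M := by
      intro z hz hjz
      have hg0 := weight_mul_norm_gradGop_le_of_ineq342 (len := len) hB₀ h342 hlin π hπ hR₁ hω
        (fun u => pow_nonneg (B8ScaledSupNorm.scale_pos hL hη u.1.1).le 2) hex1 hS ν f hM hMf ⟨(z, μ), hz⟩
      have hw2 : weight L x.i.η (-(2 : ℝ)) j ≤ ((L : ℝ) ^ (π ⟨(z, μ), hz⟩).1.1 * x.i.η) ^ 2 := weight_two_le hL hη hjz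
      exact (mul_le_mul_of_nonneg_right hw2 (norm_nonneg _)).trans hg0
    have he1 := hend p.1 (hPΩ j hj p.1 μ hxΩ) hju
    have he2 := hend p.2 (hPΩ j hj p.2 μ hx'Ω) hju'
    have h4 : ((1 / 4 : ℝ)) ^ (-β) = (4 : ℝ) ^ β := by
      rw [Real.rpow_neg (by norm_num), one_div, Real.inv_rpow (by norm_num), inv_inv]
    rw [h4] at hfar
    have h4β : 0 ≤ (4 : ℝ) ^ β := Real.rpow_nonneg (by norm_num) β
    calc weight L x.i.η (-(2 + β)) j * hquot x.i.η β len U.1 (covDerivFwd x.i.η U.1 ν (fun z => ops.Gop U.1 (extZd P f) z μ)) p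
        ≤ (4 : ℝ) ^ β * (weight L x.i.η (-(2 : ℝ)) j * ‖covDerivFwd x.i.η U.1 ν (fun z => ops.Gop U.1 (extZd P f) z μ) p.1‖ +
            weight L x.i.η (-(2 : ℝ)) j * ‖covDerivFwd x.i.η U.1 ν (fun z => ops.Gop U.1 (extZd P f) z μ) p.2‖) := hfar
      _ ≤ (4 : ℝ) ^ β * (B₀ * R₁ * S * M + B₀ * R₁ * S * M) := mul_le_mul_of_nonneg_left (add_le_add he1 he2) h4β
      _ = 2 * (4 : ℝ) ^ β * (B₀ * R₁ * S) * M := by ring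
      _ ≤ (max 0 (Bβ β) * R * S + 2 * (4 : ℝ) ^ β * (B₀ * R₁ * S)) * M := by nlinarith

/-! ## §3 The weighted-sup form: the repaired binder's shape on a finite member -/

/-- ★★ **THE REPAIRED HÖLDER BINDER's SHAPE, SUPPLIED ON A FINITE MEMBER**: under the data of `weight_mul_hquot_gradGop_le_both`, the weighted supremum over
`j ≤ m` and the pairs `(x, x′)` admissible with `x ∈ Ω_j` AND `x′ ∈ Ω_j` of the (3.40) quotients of `∇_{U,ν}G(U₀)f̃` (all components `ν, μ`) is at most
`(max{0,Bβ β}·R·S + 2·4^β·B₀·R₁·S)·M` — B8 (1.36)'s Hölder line «on Ω_j» for `A = G(U₀)f̃` with both points in `Ω_j`, constants through the Lemma-2.1 letters.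
[cite: Balaban1985RegularSpaces, (1.36) p.82, (1.59) p.86, (1.62) + Prop. 3 p.87; Balaban1985BackgroundPropagators, Thm 3.3 p.399, (3.42)–(3.43) pp.397–398; Balaban1984PropagatorsII, Lemma 2.1 p.234] -/
theorem holderBoth_msup_le {x : MemberZd d L} [Fintype (BSite L x)] (hL : 1 ≤ L) {ops : OpsZd d 𝔸} {U : CfgZd d 𝔸}
    {B₀ δ₀ β : ℝ} {Bβ Bε : ℝ → ℝ} {Bεβ : ℝ → ℝ → ℝ} (hB₀ : 0 ≤ B₀)
    (h342 : B9.Ineq342_346_347 (GAZdOfOps 𝔸 L len x ops) B₀ δ₀ U) (h345 : B9.Ineq343_345 (GAZdOfOps 𝔸 L len x ops) Bβ Bε Bεβ δ₀ U)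
    (hβ0 : 0 ≤ β) (hβ1 : β < 1) (hlen1 : ∀ v : Site d, 0 < len v → 1 ≤ len v)
    (hlen : ∀ z z' : Site d, (linfDist z z' : ℝ) ≤ len (z' - z))
    (hlin : ∀ (c : ℝ) (A B : Site d → Fin d → 𝔸), ops.Gop U.1 (c • A + B) = c • ops.Gop U.1 A + ops.Gop U.1 B)
    {P : Site d × Fin d → Prop} (π : {b : Site d × Fin d // P b} → BSite L x)
    (hπ : ∀ b, b.1.1 ∈ blockZd L (π b).1.1 (π b).1.2)
    (hPΩ : ∀ j, j ≤ x.m → ∀ (z : Site d) (μ : Fin d), z ∈ x.i.Ω j → P (z, μ))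
    (hlev : ∀ (b : {b : Site d × Fin d // P b}) (j : ℕ), j ≤ x.m → b.1.1 ∈ x.i.Ω j → j ≤ (π b).1.1)
    {κ₂ R R₁ S : ℝ} (hR : 0 ≤ R) (hR₁ : 0 ≤ R₁) {ω : BSite L x → ℝ} (hω : ∀ v, 0 < ω v)
    (hexH : ∀ u v : BSite L x, ((L : ℝ) ^ u.1.1 * x.i.η) ^ (2 + β) *
      (((L : ℝ) ^ u.1.1 * x.i.η) ^ (1 - β) * cutHZd x.i.η β len (zetaZd L u.1.1 u.1.2)) ≤ R * Real.exp (κ₂ * distZd L x u v) * ω v)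
    (hex1 : ∀ u v : BSite L x, ((L : ℝ) ^ u.1.1 * x.i.η) ^ 2 * ((L : ℝ) ^ u.1.1 * x.i.η) ≤ R₁ * Real.exp (κ₂ * distZd L x u v) * ω v)
    (hS : ∀ u : BSite L x, ∑ v, Real.exp (-((δ₀ - κ₂) * distZd L x u v)) ≤ S)
    (hS0 : 0 ≤ S) (f : {b : Site d × Fin d // P b} → 𝔸) {M : ℝ} (hM : 0 ≤ M) (hMf : ∀ y, ω (π y) * ‖f y‖ ≤ M) :
    msup L x.m x.i.η (-(2 + β))
        (fun j (q : Fin d × Fin d × (Site d × Site d)) => q.2.2 ∈ AdmPair x.i.η len ∧ q.2.2.1 ∈ x.i.Ω j ∧ q.2.2.2 ∈ x.i.Ω j)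
        (fun q => hquot x.i.η β len U.1 (covDerivFwd x.i.η U.1 q.1 (fun z => ops.Gop U.1 (extZd P f) z q.2.1)) q.2.2) ≤
      (max 0 (Bβ β) * R * S + 2 * (4 : ℝ) ^ β * (B₀ * R₁ * S)) * M := by
  have hη : 0 < x.i.η := x.i.hη
  have hC : 0 ≤ (max 0 (Bβ β) * R * S + 2 * (4 : ℝ) ^ β * (B₀ * R₁ * S)) * M := by positivity
  refine B8ScaledSupNorm.msup_le hC fun j hj q hq => ?_
  obtain ⟨hp, hxΩ, hx'Ω⟩ := hq
  rw [Real.norm_of_nonneg (hquot_nonneg hη.le β U.1 _ hp)]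
  exact weight_mul_hquot_gradGop_le_both hL hB₀ h342 h345 hβ0 hβ1 hlen1 hlen hlin π hπ hPΩ hlev hR hR₁ hω hexH hex1 hS q.1 f hM hMf hj q.2.1
    hp hxΩ hx'Ω


/-- ★ **WITH PRINT's RIGHT-HAND SIDE `|J|₍₋₃₎`**: if (G3) every block's level is a class of the bonds it carries (`b ∈ Ω_{j_{πb}}` in the bond convention) and
the `(−3)`-family of `f̃` is bounded (true on a finite member: finitely many non-zero values), then with `ω(v) := (L^{j_v}η)³` the weight `M` may be taken to be
`|f̃|₍₋₃₎ = bondNorm L m η (−3) Ω f̃`, and the repaired Hölder reading is `≤ (max{0,Bβ β}·R·S + 2·4^β·B₀·R₁·S)·|f̃|₍₋₃₎` — the shape «‖∇_UG(U₀)J‖ ≤ C·B₀(β)·|J|₍₋₃₎» of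
B8 (1.59)∕(1.62) with both points in `Ω_j`. [cite: Balaban1985RegularSpaces, (1.59) p.86, (1.62) + Prop. 3 p.87, (1.36) p.82; Balaban1985BackgroundPropagators, (3.41) p.397, Thm 3.3 p.399; Balaban1984PropagatorsII, Lemma 2.1 p.234] -/
theorem holderBoth_msup_le_bondNorm {x : MemberZd d L} [Fintype (BSite L x)] (hL : 1 ≤ L) {ops : OpsZd d 𝔸} {U : CfgZd d 𝔸}
    {B₀ δ₀ β : ℝ} {Bβ Bε : ℝ → ℝ} {Bεβ : ℝ → ℝ → ℝ} (hB₀ : 0 ≤ B₀)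
    (h342 : B9.Ineq342_346_347 (GAZdOfOps 𝔸 L len x ops) B₀ δ₀ U) (h345 : B9.Ineq343_345 (GAZdOfOps 𝔸 L len x ops) Bβ Bε Bεβ δ₀ U)
    (hβ0 : 0 ≤ β) (hβ1 : β < 1) (hlen1 : ∀ v : Site d, 0 < len v → 1 ≤ len v)
    (hlen : ∀ z z' : Site d, (linfDist z z' : ℝ) ≤ len (z' - z))
    (hlin : ∀ (c : ℝ) (A B : Site d → Fin d → 𝔸), ops.Gop U.1 (c • A + B) = c • ops.Gop U.1 A + ops.Gop U.1 B)
    {P : Site d × Fin d → Prop} (π : {b : Site d × Fin d // P b} → BSite L x)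
    (hπ : ∀ b, b.1.1 ∈ blockZd L (π b).1.1 (π b).1.2)
    (hPΩ : ∀ j, j ≤ x.m → ∀ (z : Site d) (μ : Fin d), z ∈ x.i.Ω j → P (z, μ))
    (hlev : ∀ (b : {b : Site d × Fin d // P b}) (j : ℕ), j ≤ x.m → b.1.1 ∈ x.i.Ω j → j ≤ (π b).1.1)
    (hlev₂ : ∀ b : {b : Site d × Fin d // P b}, BondTouches (x.i.Ω (π b).1.1) b.1.1 b.1.2)
    {κ₂ R R₁ S : ℝ} (hR : 0 ≤ R) (hR₁ : 0 ≤ R₁)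
    (hexH : ∀ u v : BSite L x, ((L : ℝ) ^ u.1.1 * x.i.η) ^ (2 + β) *
      (((L : ℝ) ^ u.1.1 * x.i.η) ^ (1 - β) * cutHZd x.i.η β len (zetaZd L u.1.1 u.1.2)) ≤
        R * Real.exp (κ₂ * distZd L x u v) * ((L : ℝ) ^ v.1.1 * x.i.η) ^ 3)
    (hex1 : ∀ u v : BSite L x, ((L : ℝ) ^ u.1.1 * x.i.η) ^ 2 * ((L : ℝ) ^ u.1.1 * x.i.η) ≤
      R₁ * Real.exp (κ₂ * distZd L x u v) * ((L : ℝ) ^ v.1.1 * x.i.η) ^ 3)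
    (hS : ∀ u : BSite L x, ∑ v, Real.exp (-((δ₀ - κ₂) * distZd L x u v)) ≤ S)
    (hS0 : 0 ≤ S) (f : {b : Site d × Fin d // P b} → 𝔸)
    (hBdd : Bdd L x.m x.i.η (-(3 : ℝ)) (fun j (b : Site d × Fin d) => BondTouches (x.i.Ω j) b.1 b.2) (fun b => extZd P f b.1 b.2)) :
    msup L x.m x.i.η (-(2 + β))
        (fun j (q : Fin d × Fin d × (Site d × Site d)) => q.2.2 ∈ AdmPair x.i.η len ∧ q.2.2.1 ∈ x.i.Ω j ∧ q.2.2.2 ∈ x.i.Ω j)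
        (fun q => hquot x.i.η β len U.1 (covDerivFwd x.i.η U.1 q.1 (fun z => ops.Gop U.1 (extZd P f) z q.2.1)) q.2.2) ≤
      (max 0 (Bβ β) * R * S + 2 * (4 : ℝ) ^ β * (B₀ * R₁ * S)) * bondNorm L x.m x.i.η (-(3 : ℝ)) x.i.Ω (extZd P f) := by
  have hη : 0 < x.i.η := x.i.hη
  have hω : ∀ v : BSite L x, 0 < ((L : ℝ) ^ v.1.1 * x.i.η) ^ 3 := fun v => pow_pos (B8ScaledSupNorm.scale_pos hL hη v.1.1) 3
  have hM : 0 ≤ bondNorm L x.m x.i.η (-(3 : ℝ)) x.i.Ω (extZd P f) := B8ScaledSupNorm.msup_nonneg L x.m hη.le _ _ _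
  have hMf : ∀ y : {b : Site d × Fin d // P b}, ((L : ℝ) ^ (π y).1.1 * x.i.η) ^ 3 * ‖f y‖ ≤ bondNorm L x.m x.i.η (-(3 : ℝ)) x.i.Ω (extZd P f) := by
    intro y
    have e3 : (-(3 : ℝ)) = -((3 : ℕ) : ℝ) := by norm_num
    have hw : weight L x.i.η (-(3 : ℝ)) (π y).1.1 = ((L : ℝ) ^ (π y).1.1 * x.i.η) ^ 3 := by rw [e3, B8ScaledSupNorm.weight_neg_natCast]
    have hval : ‖f y‖ = ‖extZd P f y.1.1 y.1.2‖ := by rw [B9Eq347GlobalFromLocalZd.extZd_apply_of f y]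
    rw [← hw, hval]
    exact weight_mul_norm_le_msup hBdd (π y).2.1 (i := (y.1.1, y.1.2)) (hlev₂ y)
  exact holderBoth_msup_le hL hB₀ h342 h345 hβ0 hβ1 hlen1 hlen hlin π hπ hPΩ hlev hR hR₁ hω hexH hex1 hS hS0 f hM hMf


/-- ★ **THE SAME IN THE BINDER OWNER's CONSTANT SHAPE** (dag-n06-b EDITION δ₂ word, 2026-08-28T02:09Z: `CH δ₀ · (B₀ + max{0, Bβ β}) · M`): the bound of
`holderBoth_msup_le` factors as `max{R·S, 2·4^β·R₁·S} · (B₀ + max{0, Bβ β}) · M`, so the re-typed binder `HolderAtδ2` is discharged on a finite member with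
`CH δ₀ := max{R·S, 2·4^β·R₁·S}` (the Lemma-2.1 letters at rate `δ₀`). [cite: Balaban1985RegularSpaces, (1.36) p.82, (1.59) p.86, Prop. 3 p.87; Balaban1985BackgroundPropagators, Thm 3.3 p.399, (3.42)–(3.43) pp.397–398; Balaban1984PropagatorsII, Lemma 2.1 p.234] -/
theorem holderBoth_msup_le_CH {x : MemberZd d L} [Fintype (BSite L x)] (hL : 1 ≤ L) {ops : OpsZd d 𝔸} {U : CfgZd d 𝔸}
    {B₀ δ₀ β : ℝ} {Bβ Bε : ℝ → ℝ} {Bεβ : ℝ → ℝ → ℝ} (hB₀ : 0 ≤ B₀)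
    (h342 : B9.Ineq342_346_347 (GAZdOfOps 𝔸 L len x ops) B₀ δ₀ U) (h345 : B9.Ineq343_345 (GAZdOfOps 𝔸 L len x ops) Bβ Bε Bεβ δ₀ U)
    (hβ0 : 0 ≤ β) (hβ1 : β < 1) (hlen1 : ∀ v : Site d, 0 < len v → 1 ≤ len v)
    (hlen : ∀ z z' : Site d, (linfDist z z' : ℝ) ≤ len (z' - z))
    (hlin : ∀ (c : ℝ) (A B : Site d → Fin d → 𝔸), ops.Gop U.1 (c • A + B) = c • ops.Gop U.1 A + ops.Gop U.1 B)
    {P : Site d × Fin d → Prop} (π : {b : Site d × Fin d // P b} → BSite L x)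
    (hπ : ∀ b, b.1.1 ∈ blockZd L (π b).1.1 (π b).1.2)
    (hPΩ : ∀ j, j ≤ x.m → ∀ (z : Site d) (μ : Fin d), z ∈ x.i.Ω j → P (z, μ))
    (hlev : ∀ (b : {b : Site d × Fin d // P b}) (j : ℕ), j ≤ x.m → b.1.1 ∈ x.i.Ω j → j ≤ (π b).1.1)
    {κ₂ R R₁ S : ℝ} (hR : 0 ≤ R) (hR₁ : 0 ≤ R₁) {ω : BSite L x → ℝ} (hω : ∀ v, 0 < ω v)
    (hexH : ∀ u v : BSite L x, ((L : ℝ) ^ u.1.1 * x.i.η) ^ (2 + β) *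
      (((L : ℝ) ^ u.1.1 * x.i.η) ^ (1 - β) * cutHZd x.i.η β len (zetaZd L u.1.1 u.1.2)) ≤ R * Real.exp (κ₂ * distZd L x u v) * ω v)
    (hex1 : ∀ u v : BSite L x, ((L : ℝ) ^ u.1.1 * x.i.η) ^ 2 * ((L : ℝ) ^ u.1.1 * x.i.η) ≤ R₁ * Real.exp (κ₂ * distZd L x u v) * ω v)
    (hS : ∀ u : BSite L x, ∑ v, Real.exp (-((δ₀ - κ₂) * distZd L x u v)) ≤ S)
    (hS0 : 0 ≤ S) (f : {b : Site d × Fin d // P b} → 𝔸) {M : ℝ} (hM : 0 ≤ M) (hMf : ∀ y, ω (π y) * ‖f y‖ ≤ M) :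
    msup L x.m x.i.η (-(2 + β))
        (fun j (q : Fin d × Fin d × (Site d × Site d)) => q.2.2 ∈ AdmPair x.i.η len ∧ q.2.2.1 ∈ x.i.Ω j ∧ q.2.2.2 ∈ x.i.Ω j)
        (fun q => hquot x.i.η β len U.1 (covDerivFwd x.i.η U.1 q.1 (fun z => ops.Gop U.1 (extZd P f) z q.2.1)) q.2.2) ≤
      max (R * S) (2 * (4 : ℝ) ^ β * R₁ * S) * (B₀ + max 0 (Bβ β)) * M := by
  have h := holderBoth_msup_le (len := len) hL hB₀ h342 h345 hβ0 hβ1 hlen1 hlen hlin π hπ hPΩ hlev hR hR₁ hω hexH hex1 hS hS0 f hM hMf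
  refine h.trans ?_
  have ha : 0 ≤ max 0 (Bβ β) := le_max_left _ _
  have h1 : max 0 (Bβ β) * R * S ≤ max (R * S) (2 * (4 : ℝ) ^ β * R₁ * S) * max 0 (Bβ β) := by
    calc max 0 (Bβ β) * R * S = (R * S) * max 0 (Bβ β) := by ring
      _ ≤ max (R * S) (2 * (4 : ℝ) ^ β * R₁ * S) * max 0 (Bβ β) := mul_le_mul_of_nonneg_right (le_max_left _ _) ha
  have h2 : 2 * (4 : ℝ) ^ β * (B₀ * R₁ * S) ≤ max (R * S) (2 * (4 : ℝ) ^ β * R₁ * S) * B₀ := by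
    calc 2 * (4 : ℝ) ^ β * (B₀ * R₁ * S) = (2 * (4 : ℝ) ^ β * R₁ * S) * B₀ := by ring
      _ ≤ max (R * S) (2 * (4 : ℝ) ^ β * R₁ * S) * B₀ := mul_le_mul_of_nonneg_right (le_max_right _ _) hB₀
  have h3 : max 0 (Bβ β) * R * S + 2 * (4 : ℝ) ^ β * (B₀ * R₁ * S) ≤ max (R * S) (2 * (4 : ℝ) ^ β * R₁ * S) * (B₀ + max 0 (Bβ β)) := by
    nlinarith
  exact mul_le_mul_of_nonneg_right h3 hM


/-! ## §4 Letter-free on a finite member: the Lemma-2.1 letters inhabited by member-dependent constants -/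

/-- ★★ **THE REPAIRED HÖLDER LINE ON ONE FINITE-BLOCK MEMBER, NO LETTER LEFT** (member-dependent constants, stated as such — g0's `…ZdFinite` road for the
Hölder line): the exchange letters at `κ₂ := 0` by `exchangeLetter_of_fintype` (largest output factor over smallest source weight), the row letter by
`rowLetter_of_fintype` (`Σ_v e^{−δ₀d(u,v)} ≤ |𝔅|`, `0 ≤ δ₀`), the block assignment by choice (`blkChoice` on the bonds based in some block); what stays
DISPLAYED is geometry of the member — (G1′) `hcover`: every site of every `Ω_j` (`j ≤ m`) lies in some block of `𝔅`; (G2′) `hlevel`: a block of level `j_y` meets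
`Ω_j` only for `j ≤ j_y` (print's «Λ_j ⊂ Ω_j∖Ω_{j+1}») — and Theorem 3.3's two blocks at the genuine readings.  Conclusion: the both-points weighted Hölder
supremum of `∇_UG(U₀)f̃` is `≤ (max{0,Bβ β}·R_H + 2·4^β·B₀·R₁)·|𝔅|·M`, `R_H = (max_u (L^{j_u}η)³·cutHZd(ζ_u))·(max_v ω(v)⁻¹)`, `R₁ = (max_u (L^{j_u}η)³)·(max_v ω(v)⁻¹)`.
NOT print's member-uniform constant ((L-H2): `cutHZd(ζ_u) ≈ (L^{j_u}η)^{−β}`). [cite: Balaban1985RegularSpaces, (1.36) p.82, (1.59) p.86, (1.62) + Prop. 3 p.87; Balaban1985BackgroundPropagators, Thm 3.3 p.399, (3.42)–(3.43) pp.397–398; Balaban1984PropagatorsII, Lemma 2.1 p.234 (shape only)] -/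
theorem holderBoth_msup_le_fintype {x : MemberZd d L} [Fintype (BSite L x)] [Nonempty (BSite L x)] (hL : 1 ≤ L) {ops : OpsZd d 𝔸} {U : CfgZd d 𝔸}
    {B₀ δ₀ β : ℝ} {Bβ Bε : ℝ → ℝ} {Bεβ : ℝ → ℝ → ℝ} (hB₀ : 0 ≤ B₀) (hδ₀ : 0 ≤ δ₀)
    (h342 : B9.Ineq342_346_347 (GAZdOfOps 𝔸 L len x ops) B₀ δ₀ U) (h345 : B9.Ineq343_345 (GAZdOfOps 𝔸 L len x ops) Bβ Bε Bεβ δ₀ U)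
    (hβ0 : 0 ≤ β) (hβ1 : β < 1) (hlen1 : ∀ v : Site d, 0 < len v → 1 ≤ len v)
    (hlen : ∀ z z' : Site d, (linfDist z z' : ℝ) ≤ len (z' - z))
    (hlin : ∀ (c : ℝ) (A B : Site d → Fin d → 𝔸), ops.Gop U.1 (c • A + B) = c • ops.Gop U.1 A + ops.Gop U.1 B)
    (hcover : ∀ j, j ≤ x.m → ∀ z : Site d, z ∈ x.i.Ω j → ∃ y : BSite L x, z ∈ blockZd L y.1.1 y.1.2)
    (hlevel : ∀ (y : BSite L x) (z : Site d), z ∈ blockZd L y.1.1 y.1.2 → ∀ j, j ≤ x.m → z ∈ x.i.Ω j → j ≤ y.1.1)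
    {ω : BSite L x → ℝ} (hω : ∀ v, 0 < ω v)
    (f : {b : Site d × Fin d // InSomeBlock L x b} → 𝔸) {M : ℝ} (hM : 0 ≤ M) (hMf : ∀ y, ω (blkChoice L x y) * ‖f y‖ ≤ M) :
    msup L x.m x.i.η (-(2 + β))
        (fun j (q : Fin d × Fin d × (Site d × Site d)) => q.2.2 ∈ AdmPair x.i.η len ∧ q.2.2.1 ∈ x.i.Ω j ∧ q.2.2.2 ∈ x.i.Ω j)
        (fun q => hquot x.i.η β len U.1 (covDerivFwd x.i.η U.1 q.1 (fun z => ops.Gop U.1 (extZd (InSomeBlock L x) f) z q.2.1)) q.2.2) ≤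
      (max 0 (Bβ β) *
          ((Finset.univ.sup' Finset.univ_nonempty fun u : BSite L x =>
              ((L : ℝ) ^ u.1.1 * x.i.η) ^ (2 + β) * (((L : ℝ) ^ u.1.1 * x.i.η) ^ (1 - β) * cutHZd x.i.η β len (zetaZd L u.1.1 u.1.2))) *
            (Finset.univ.sup' Finset.univ_nonempty fun v : BSite L x => (ω v)⁻¹)) * (Fintype.card (BSite L x) : ℝ) +
        2 * (4 : ℝ) ^ β * (B₀ *
          ((Finset.univ.sup' Finset.univ_nonempty fun u : BSite L x => ((L : ℝ) ^ u.1.1 * x.i.η) ^ 2 * ((L : ℝ) ^ u.1.1 * x.i.η)) *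
            (Finset.univ.sup' Finset.univ_nonempty fun v : BSite L x => (ω v)⁻¹)) * (Fintype.card (BSite L x) : ℝ))) * M := by
  have hη : 0 < x.i.η := x.i.hη
  have haH : ∀ u : BSite L x, 0 ≤ ((L : ℝ) ^ u.1.1 * x.i.η) ^ (2 + β) *
      (((L : ℝ) ^ u.1.1 * x.i.η) ^ (1 - β) * cutHZd x.i.η β len (zetaZd L u.1.1 u.1.2)) := fun u =>
    mul_nonneg (Real.rpow_nonneg (B8ScaledSupNorm.scale_pos hL hη u.1.1).le _)
      (B9Eq343HolderGlobalFromLocalZd.blockFactor_nonneg (len := len) x β (fun u => zetaZd L u.1.1 u.1.2) u)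
  have ha1 : ∀ u : BSite L x, 0 ≤ ((L : ℝ) ^ u.1.1 * x.i.η) ^ 2 * ((L : ℝ) ^ u.1.1 * x.i.η) := fun u =>
    mul_nonneg (sq_nonneg _) (B8ScaledSupNorm.scale_pos hL hη u.1.1).le
  have hPΩ : ∀ j, j ≤ x.m → ∀ (z : Site d) (μ : Fin d), z ∈ x.i.Ω j → InSomeBlock L x (z, μ) := fun j hj z μ hz => hcover j hj z hz
  have hlev : ∀ (b : {b : Site d × Fin d // InSomeBlock L x b}) (j : ℕ), j ≤ x.m → b.1.1 ∈ x.i.Ω j → j ≤ (blkChoice L x b).1.1 :=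
    fun b j hj hb => hlevel (blkChoice L x b) b.1.1 (blkChoice_spec L x b) j hj hb
  have h := holderBoth_msup_le (len := len) hL hB₀ h342 h345 hβ0 hβ1 hlen1 hlen hlin (blkChoice L x) (blkChoice_spec L x) hPΩ hlev
    (κ₂ := 0) (exchangeConst_nonneg hω haH) (exchangeConst_nonneg hω ha1) hω
    (fun u v => exchangeLetter_of_fintype hω haH u v) (fun u v => exchangeLetter_of_fintype hω ha1 u v)
    (fun u => by rw [sub_zero]; exact rowLetter_of_fintype hδ₀ u) (Nat.cast_nonneg _) f hM hMf
  refine h.trans (le_of_eq ?_)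
  ring


/-! ## §5 A6: the hypothesis set of §4 is inhabited (zero-letter plug on the single-site member) -/

omit [Nontrivial 𝔸] in
/-- ★ **A6 ∕ NON-VACUITY OF `holderBoth_msup_le_fintype`'s HYPOTHESIS SET** — the single-site member (`Ω₀ = Λ₀ = {0}`, `Ω_j = ∅` for `j ≥ 1`, no averaging
bonds, truncation `m = 0`, `η = 1`) has exactly one block `Δ(0) = {0}`; its `𝔅` is finite and non-empty, every site of `Ω₀` lies in that block (G1′), the block
meets `Ω_j` only for `j = 0` (G2′); at the letter record with ALL FOUR letters `0` every (3.42)–(3.47) reading of `GAZdOfOps` vanishes (g0's `…_gop_zero` lemmas +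
`msup` of a zero family), so both Theorem-3.3 blocks hold with the constants `0`; `G(U) = 0` is ℝ-linear.  Labelled A6: a JOINT SATISFIABILITY witness of the
hypothesis set, not print's regime (print's `G(U₀) = (Ω₀Δ_aΩ₀)⁻¹` is dag-n06-w4's `gopZd`, whose Theorem-3.3 blocks are N06's node).
[cite: Balaban1985BackgroundPropagators, Thm 3.3 p.399 (shape only); Balaban1985RegularSpaces, (1.28) p.81 (the block geometry)] -/
theorem holderBoth_hypotheses_inhabited (d L : ℕ) (M₀ : ℝ) (len : Site d → ℝ) :
    ∃ x : MemberZd d L, Finite (BSite L x) ∧ Nonempty (BSite L x) ∧ x.M = M₀ ∧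
      (∀ j, j ≤ x.m → ∀ z : Site d, z ∈ x.i.Ω j → ∃ y : BSite L x, z ∈ blockZd L y.1.1 y.1.2) ∧
      (∀ (y : BSite L x) (z : Site d), z ∈ blockZd L y.1.1 y.1.2 → ∀ j, j ≤ x.m → z ∈ x.i.Ω j → j ≤ y.1.1) ∧
      ∃ (ops : OpsZd d 𝔸) (U : CfgZd d 𝔸),
        (∀ (c : ℝ) (A B : Site d → Fin d → 𝔸), ops.Gop U.1 (c • A + B) = c • ops.Gop U.1 A + ops.Gop U.1 B) ∧
        B9.Ineq342_346_347 (GAZdOfOps 𝔸 L len x ops) 0 0 U ∧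
        B9.Ineq343_345 (GAZdOfOps 𝔸 L len x ops) (fun _ => 0) (fun _ => 0) (fun _ _ => 0) 0 U := by
  classical
  -- the single-site datum
  let i₀ : ZdIdx d L :=
    { η := 1
      hη := one_pos
      k := 1
      hk := le_rfl
      Ω := fun j => {z | z = 0 ∧ j = 0}
      hΩ := fun j z hz => by simp at hz
      Λs := fun _ j => {z | z = 0 ∧ j = 0}
      Λb := fun _ _ => ∅
      hbox := fun m _ j _ c hc => by simp at hc
      hclass := fun m _ j _ c hc => by simp at hc
      htower := by
        rintro j - y ⟨rfl, rfl⟩ z hz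
        refine ⟨funext fun μ => le_antisymm (by simpa using (hz μ).2) (by simpa using (hz μ).1), rfl⟩
      hpart := by
        rintro z ⟨rfl, -⟩
        exact ⟨0, Nat.zero_le _, 0, ⟨rfl, rfl⟩, fun μ => ⟨le_rfl, le_rfl⟩⟩ }
  let x : MemberZd d L := ⟨M₀, i₀, 0⟩
  -- its `𝔅` is the one block `(0, 0)`
  have hB : ∀ y : BSite L x, y.1 = (0, 0) := by
    intro y
    obtain ⟨⟨j, z⟩, hj, hz0, hj0⟩ := y
    change z = 0 at hz0
    change j = 0 at hj0
    subst hz0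
    subst hj0
    rfl
  let y₀ : BSite L x := ⟨(0, 0), le_rfl, ⟨rfl, rfl⟩⟩
  have hfin : Finite (BSite L x) := by
    haveI : Subsingleton (BSite L x) := ⟨fun a b => Subtype.ext ((hB a).trans (hB b).symm)⟩
    infer_instance
  -- the zero letter record and the flat unitary configuration
  let ops : OpsZd d 𝔸 := ⟨fun _ _ _ _ => 0, fun _ _ _ _ => 0, fun _ _ _ _ => 0, fun _ _ _ _ => 0⟩
  have hG : ∀ (U : Site d → Fin d → 𝔸ˣ) (J : Site d → Fin d → 𝔸), ops.Gop U J = 0 := fun _ _ => rfl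
  let U : CfgZd d 𝔸 := ⟨1, fun _ _ => (B7Prop2Explicit.unitaryUnits 𝔸).one_mem⟩
  refine ⟨x, hfin, ⟨y₀⟩, rfl, ?_, ?_, ops, U, ?_, ?_, ?_⟩
  · -- (G1′): every site of `Ω_j` (only `j = 0`, `z = 0`) lies in the block `Δ(0) = {0}`
    rintro j hj z ⟨rfl, rfl⟩
    refine ⟨y₀, fun μ => ?_⟩
    change B8Ineq130.tlo L (0 : Site d) 0 μ ≤ (0 : Site d) μ ∧ (0 : Site d) μ ≤ B8Ineq130.thi L (0 : Site d) 0 μ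
    exact ⟨le_rfl, le_rfl⟩
  · -- (G2′): `Ω_j` is empty for `j ≥ 1`
    rintro y z - j hj ⟨-, rfl⟩
    exact Nat.zero_le _
  · intro c A B
    simp [hG]
  · -- the (3.42) ∕ (3.46) ∕ (3.47) block with constants 0: every reading vanishes
    refine ⟨fun n J y y' _ => ?_, fun n J h y y' _ _ => ?_, fun n J γ _ _ => ?_⟩
    · rw [B9SupplySockB9P3ZdLocalLettersOfOps.GAZdOfOps_e, B9SupplySockB9P3ZdLocalLettersOfOps.eOfOps_gop_zero hG]; simp
    · rw [B9SupplySockB9P3ZdLocalLettersOfOps.GAZdOfOps_l2, B9SupplySockB9P3ZdLocalLettersOfOps.l2OfOps_gop_zero hG]; simp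
    · rw [B9SupplySockB9P3ZdLocalLettersOfOps.GAZdOfOps_glob, zero_mul]
      fin_cases n
      · simp [B9SupplySockB9P3ZdFrame.globZd, hG, msup]
      · simp [B9SupplySockB9P3ZdFrame.globZd, hG, msup, B8Eq138LandauZd.covDerivFwd_zero_fun]
      · simp [B9SupplySockB9P3ZdFrame.globZd, B9SupplySockB9P3ZdLocalLettersOfOps.glob2OfOps_gop_zero hG]
      · have hcl : ∀ z : Site d, B8Eq138LandauZd.covLap x.i.η U.1 (fun _ => (0 : 𝔸)) z = 0 := fun z =>
          B8Eq138LandauZd.covLap_zero (η := x.i.η) (U₀ := U.1) z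
        simp [B9SupplySockB9P3ZdFrame.globZd, hG, bondNorm, msup, hcl]
  · -- the (3.43) ∕ (3.44) ∕ (3.45) block with constants 0
    refine ⟨fun β J ζ y y' _ _ _ _ => ?_, fun ε J y y' _ _ _ => ?_, fun ε β J ζ y y' _ _ _ _ _ _ => ?_⟩
    · rw [B9SupplySockB9P3ZdLocalLettersOfOps.GAZdOfOps_h1, B9SupplySockB9P3ZdLocalLettersOfOps.h1OfOps_gop_zero hG]; simp
    · rw [B9SupplySockB9P3ZdLocalLettersOfOps.GAZdOfOps_e4, B9SupplySockB9P3ZdLocalLettersOfOps.e4OfOps_gop_zero hG]; simp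
    · rw [B9SupplySockB9P3ZdLocalLettersOfOps.GAZdOfOps_h2, B9SupplySockB9P3ZdLocalLettersOfOps.h2OfOps_gop_zero hG]; simp

end Main

end Literature.MathematicalPhysics.QuantumFieldTheory.Balaban1983to89.B9Eq343HolderBothZdFinite

end
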